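import Summits.QuantumFields.YangMills.Theorems.IRcofAdaptedSpectralDataCore
import HarnessLib

/-!
# Line `inplane_squaring_ladder` on crux `IRcof` ⟨stmt-QuantumFields-26930⟩ — the registered stub
# `stub_adaptedSpectralData : AdaptedSpectralData` BY NAME (helper lane; R2c cell `ym-gapexp`)

Director-ym R660-ym (1); critic of record `ymfull-r2c-crit-1` (CUT-9 §A «HAND-READY STUB», HELPER-ROUTE cd1427fa99c0a313).
Skeleton of the line: `Summits/QuantumFields/YangMills/Cruxes/IRcof/Lines/inplane_squaring_ladder.lean` sha16 2d7939aac1b7e59b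
(v1; the v1_1 reshape keeps these declarations byte-identical).  The stub's TYPE `AdaptedSpectralData` is stated over objects the
SKELETON defines — the temporal twist family `tw0`, the direction-0-neutral partition function `P0`, the flux weight `u0`, `FluxSubmultAt`,
`AdaptedSpectralDataAt`, `AdaptedSpectralData` (crux workfiles are not importable from `Theorems/`).  Following the LINE-19 precedent
(`Theorems/AllWindowsColdBoxBoxHighWindowsSU22LineDefs.lean`), §1 copies these six declarations VERBATIM (same names, same bodies, same
binders) into the namespace `Summit.QuantumFields.YangMills.Theorems.IRcofInplaneSquaringLadderLine`, and §2 gives the registry its by-name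
inhabitant `theorem stub_adaptedSpectralData : AdaptedSpectralData`, a one-line application of the def-free theorem
`IRcofAdaptedSpectralDataCore.adaptedSpectralData` (whose statement is this type with `tw0`/`P0`/`AdaptedSpectralDataAt` δ-unfolded).

WHAT THIS IS NOT.  Nothing of `Seed` (S), `Residuals` (R), `NeutralPure` (V), `CentreFreePX` (CF), `IRnscCof` (N), of `IRcof`, `IR` or the
Yang–Mills mass gap (Clay) is proved; the mathematics (finite-volume transfer-matrix bookkeeping at one `β`) is in
`IRcofAdaptedSpectralDataCore.lean`.  Finite-volume ∕ conditional; the mass gap is NOT proved.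

References: G. 't Hooft, Nucl. Phys. B 153 (1979) 141, §§4–5; I. Montvay, G. Münster, *Quantum Fields on a Lattice* (1994) §3.2.6 (3.145);
M. Reed, B. Simon, *Methods of Modern Mathematical Physics* I (1980) Thm. VI.16, VI.22–23.
-/

set_option autoImplicit false

noncomputable section

open Filter Topology MeasureTheory
open scoped BigOperators
open Literature.MathematicalPhysics.QuantumFieldTheory

namespace Summit.QuantumFields.YangMills.Theorems.IRcofInplaneSquaringLadderLine

/-! ## §1 The line's currency, VERBATIM from `Cruxes/IRcof/Lines/inplane_squaring_ladder.lean` 2d7939aac1b7e59b (§0b, §1) -/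

section Currency

variable {G : Type} [Group G] [TopologicalSpace G] [IsTopologicalGroup G] [CompactSpace G]
  [MeasurableSpace G] [BorelSpace G]

/-- The temporal twist family «g on the plane (0,3), nothing else»: (g, 1, 1, 1). VERBATIM `InplaneSquaringLadder.tw0`. -/
def tw0 (g : G) : Fin 4 → G := Function.update (1 : Fin 4 → G) 0 g

variable {N : ℕ}

/-- The direction-0-NEUTRAL partition function: n⁻¹ Σ_{e<n} Z^{(gᵉ on (0,3))}. VERBATIM `InplaneSquaringLadder.P0`. -/
def P0 (ρ : G →* Matrix (Fin N) (Fin N) ℂ) (β : ℝ) (g : G) (n : ℕ) (a b c d : ℕ) : ℝ :=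
  (n : ℝ)⁻¹ * ∑ e : Fin n, wilsonFinTorusTwistedPartition ρ β (tw0 (g ^ (e : ℕ))) a b c d

/-- The flux weight: u = 1 − P0/Z (the Gibbs weight of the direction-0-charged flux sectors). VERBATIM `InplaneSquaringLadder.u0`. -/
def u0 (ρ : G →* Matrix (Fin N) (Fin N) ℂ) (β : ℝ) (g : G) (n : ℕ) (a b c d : ℕ) : ℝ :=
  1 - P0 ρ β g n a b c d / wilsonFinTorusPartition ρ β a b c d

/-- Flux-sector sub-multiplicativity at one configuration. VERBATIM `InplaneSquaringLadder.FluxSubmultAt`. -/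
def FluxSubmultAt (ρ : G →* Matrix (Fin N) (Fin N) ℂ) (β : ℝ) (g : G) (n : ℕ) : Prop :=
  ∀ a b c d : ℕ, 1 ≤ a → 1 ≤ b → 1 ≤ c → 2 ≤ d →
    wilsonFinTorusPartition ρ β a b c (2 * d) - P0 ρ β g n a b c (2 * d) ≤
      (wilsonFinTorusPartition ρ β a b c d - P0 ρ β g n a b c d) ^ 2

end Currency

/-- **Centre-adapted spectral data** of the slice a×b×c for (ρ, β, g, n). VERBATIM `InplaneSquaringLadder.AdaptedSpectralDataAt`. -/
def AdaptedSpectralDataAt {G : Type} [Group G] [TopologicalSpace G] [IsTopologicalGroup G] [CompactSpace G]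
    [MeasurableSpace G] [BorelSpace G] {N : ℕ} (ρ : G →* Matrix (Fin N) (Fin N) ℂ) (β : ℝ) (g : G) (n : ℕ)
    (a b c : ℕ) : Prop :=
  ∃ (ι : Type) (lam w : ι → ℝ), (∀ i, 0 ≤ lam i) ∧ (∀ i, w i = 0 ∨ w i = 1) ∧
    (∀ m : ℕ, HasSum (fun i => lam i ^ (m + 2)) (wilsonFinTorusPartition ρ β a b c (m + 2))) ∧
    (∀ m : ℕ, HasSum (fun i => lam i ^ (m + 2) * w i) (P0 ρ β g n a b c (m + 2)))

/-- **Adapted spectral data exists for all boxes** — the M-class stub. VERBATIM `InplaneSquaringLadder.AdaptedSpectralData`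
(the TYPE of the registered stub `stub_adaptedSpectralData`). -/
def AdaptedSpectralData : Prop :=
  ∀ (G : Type) [Group G] [TopologicalSpace G] [IsTopologicalGroup G] [CompactSpace G],
    IsCompactSimpleLieGroup G → SimplyConnectedSpace G →
    letI : MeasurableSpace G := borel G
    haveI : BorelSpace G := ⟨rfl⟩
    ∀ (r : LatticeRep G) (β : ℝ), 0 ≤ β → ∀ g ∈ Subgroup.center G, ∀ n : ℕ, 0 < n → g ^ n = 1 →
      ∀ a b c : ℕ, 1 ≤ a → 1 ≤ b → 1 ≤ c → AdaptedSpectralDataAt r.ρ β g n a b c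

/-! ## §2 The registered stub BY NAME -/

/-- ★ **REGISTERED STUB `stub_adaptedSpectralData` (line `inplane_squaring_ladder` 2d7939aac1b7e59b), BY NAME**: for every compact simple
`G`, every `LatticeRep`, `β ≥ 0`, central `g` of finite order `n > 0` and every box, the slice transfer operator of `finTorusSliceKernel`
has a Hilbert eigenbasis ADAPTED to the flux projection of the cyclic twist group `⟨gᵉ on (0,3)⟩`: `Z(m+2) = Σ λᵢ^{m+2}` and
`P0(m+2) = Σ λᵢ^{m+2} wᵢ` with `wᵢ ∈ {0,1}` — `:= IRcofAdaptedSpectralDataCore.adaptedSpectralData` (the statement there is this type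
δ-unfolded). [cite: tHooft1979Flux, §5 (5.1)–(5.4)] [cite: MontvayMunster1994, §3.2.6 (3.145)] [cite: ReedSimonI1980, Thm. VI.16 and Thm. VI.22–23] -/
theorem stub_adaptedSpectralData : AdaptedSpectralData := by
  intro G _ _ _ _ hG hsc
  exact IRcofAdaptedSpectralDataCore.adaptedSpectralData G hG hsc

end Summit.QuantumFields.YangMills.Theorems.IRcofInplaneSquaringLadderLine

end
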